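import Summits.MatrixMultiplication.MatrixMultiplication.Theorems.SubgroupIdentityDesigns.Negative.RectangleLaw

/-!
# The triple rectangle law (negative lemmas for the crux `SubgroupIdentityDesigns`,
# stmt-MatrixMultiplication-14079) — VALUE = THEOREM (all p, explicit certificate), NOT summit
# progress; the crux stays open.

The rectangle certificate of `RectangleLaw` is evaluated DIRECTLY against an identity design,
with no appeal to pair independence and no TPP hypothesis: if `f` lies in the level-1 space,
`f 1 = 1` and `f (a b c) = 0` for every non-identity product, and the four upper Borel cells
`B(α, β)`, `(α, β) ∈ {1, a} × {1, μ}` (`a, μ ∉ {0, 1}`), are contained in the TRIPLE product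
set `{a b c}`, then `Σ_g λ_R(g) f(g) = λ_R(1) f(1) = 1`, contradicting annihilation
(`no_idTest_of_cells_in_triple`).  This reaches the third member: for a frame
`U⁺ ≤ H₁`, `U⁻ ≤ H₂`, an element `s ∈ H₃` with `s₀₀ ≠ 0` is upper-triangularised by
`v = [[1,0],[-s₁₀/s₀₀,1]] ∈ H₂`, so `U⁺ · diag(1,δ) · v · s = B(s₀₀, δ·det s/s₀₀)` lies in
`H₁H₂H₃` whenever `diag(1, δ) ∈ H₁H₂` (`cell_of_triple`).  TRIPLE RECTANGLE LAW
(`no_idTest_triple_frame`, crux vocabulary `no_levelOne_design_triple_frame`): if moreover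
`diag(1, μ), diag(1, δ₁), diag(1, δ₂) ∈ H₁H₂` with `δ₁ det s = s₀₀`, `δ₂ det s = μ s₀₀` and
`s₀₀ ≠ 1`, there is no level-1 identity design.  In particular (`no_levelOne_design_fullTorus`)
if `H₁H₂` contains every `diag(1, δ)`, `δ ≠ 0` — e.g. the top `p = 7` census family
`|T₁| = 2`, `|T₂| = 3` at the same corner — then EVERY `s ∈ H₃` must have `s₀₀ ∈ {0, 1}`.
-/

set_option linter.dupNamespace false

noncomputable section

open scoped BigOperators Classical
open Summit.MatrixMultiplication.MatrixMultiplication.Theorems.LieRankDesigns.Negative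
  (GLm Mat fourierFn)
open Summit.MatrixMultiplication.MatrixMultiplication.Theorems.LevelOneGL2Designs.Negative
  (levelSubmodule mem_levelSubmodule_iff fourierFn_mem_levelSubmodule)

namespace Summit.MatrixMultiplication.MatrixMultiplication.Theorems.SubgroupIdentityDesigns.Negative

section TripleCells

variable {p : ℕ} [hp : Fact p.Prime]

/-- The identity of `GL₂(𝔽_p)` as an explicit upper cell point. -/
theorem coe_one_eq_ucell : ((1 : GLm p 2) : Mat p 2) = !![1, 0; 0, 1] := by
  rw [Units.val_one]
  ext i j
  fin_cases i <;> fin_cases j <;> rfl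

/-- The rectangle certificate through the identity: for `a, μ ∉ {0, 1}` there is a level-1
annihilator supported on the cells over `{1, a} × {1, μ}` whose value AT THE IDENTITY is
non-zero. -/
theorem exists_urect_annihilator_one {a μ : ZMod p} (ha0 : a ≠ 0) (ha1 : a ≠ 1) (hμ0 : μ ≠ 0)
    (hμ1 : μ ≠ 1) :
    ∃ lam : GLm p 2 → ℂ, lam 1 ≠ 0 ∧
      (∀ g, lam g ≠ 0 → ∃ α β x : ZMod p, (α = 1 ∨ α = a) ∧ (β = 1 ∨ β = μ) ∧
        (g : Mat p 2) = !![α, x; 0, β]) ∧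
      ∀ F ∈ levelSubmodule p 2 1, ∑ g, lam g * F g = 0 := by
  refine ⟨fun g =>
      (∑ x : ZMod p, if (g : Mat p 2) = !![1, x; 0, 1] then (1 : ℂ) else 0)
      - (∑ x : ZMod p, if (g : Mat p 2) = !![a, x; 0, 1] then (1 : ℂ) else 0)
      - (∑ x : ZMod p, if (g : Mat p 2) = !![1, x; 0, μ] then (1 : ℂ) else 0)
      + (∑ x : ZMod p, if (g : Mat p 2) = !![a, x; 0, μ] then (1 : ℂ) else 0), ?_, ?_, ?_⟩
  · -- non-zero at the identity
    intro h
    simp only [coe_one_eq_ucell, ucell_eq_iff] at h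
    simp [Ne.symm ha1, Ne.symm hμ1, Finset.sum_ite_eq] at h
  · -- support
    intro g hg
    by_contra hne
    apply hg
    have h0 : ∀ α β : ZMod p, (α = 1 ∨ α = a) → (β = 1 ∨ β = μ) →
        (∑ x : ZMod p, if (g : Mat p 2) = !![α, x; 0, β] then (1 : ℂ) else 0) = 0 := by
      intro α β hα hβ
      exact Finset.sum_eq_zero fun x _ => if_neg fun h => hne ⟨α, β, x, hα, hβ, h⟩
    simp only [h0 1 1 (Or.inl rfl) (Or.inl rfl), h0 a 1 (Or.inr rfl) (Or.inl rfl),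
      h0 1 μ (Or.inl rfl) (Or.inr rfl), h0 a μ (Or.inr rfl) (Or.inr rfl), sub_zero, add_zero]
  · -- annihilation
    intro F hF
    obtain ⟨c, hc, hFc⟩ := mem_levelSubmodule_iff.mp hF
    have hF' : F = fourierFn c := funext hFc
    subst hF'
    simp only [sub_mul, add_mul, Finset.sum_sub_distrib, Finset.sum_add_distrib]
    rw [ucell_push 1 1 (mul_ne_zero one_ne_zero one_ne_zero) c,
      ucell_push a 1 (mul_ne_zero ha0 one_ne_zero) c,
      ucell_push 1 μ (mul_ne_zero one_ne_zero hμ0) c, ucell_push a μ (mul_ne_zero ha0 hμ0) c,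
      ← Finset.sum_sub_distrib, ← Finset.sum_sub_distrib, ← Finset.sum_add_distrib]
    refine Finset.sum_eq_zero fun M _ => ?_
    rw [← mul_sub, ← mul_sub, ← mul_add]
    by_cases hM : M.det = 0
    · rw [ucell_bracket M hM, mul_zero]
    · rw [hc M (one_lt_rank_of_det_ne_zero M hM), zero_mul]

/-- **TRIPLE RECTANGLE LAW (abstract, no TPP needed).**  If the four upper cells over
`{1, a} × {1, μ}` (`a, μ ∉ {0,1}`) consist of triple products `a' b c` (`a' ∈ H₁`, `b ∈ H₂`,
`c ∈ H₃`), then `(H₁, H₂, H₃)` has no level-1 identity test: the certificate pairs to `f(1) = 1`. -/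
theorem no_idTest_of_cells_in_triple {H₁ H₂ H₃ : Subgroup (GLm p 2)} {a μ : ZMod p}
    (ha0 : a ≠ 0) (ha1 : a ≠ 1) (hμ0 : μ ≠ 0) (hμ1 : μ ≠ 1)
    (hcell : ∀ α β : ZMod p, (α = 1 ∨ α = a) → (β = 1 ∨ β = μ) → ∀ x : ZMod p,
      ∃ a' ∈ H₁, ∃ b ∈ H₂, ∃ c ∈ H₃, ((a' * b * c : GLm p 2) : Mat p 2) = !![α, x; 0, β]) :
    ¬ ∃ f ∈ levelSubmodule p 2 1, f 1 = 1 ∧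
        ∀ a' ∈ H₁, ∀ b ∈ H₂, ∀ c ∈ H₃, a' * b * c ≠ 1 → f (a' * b * c) = 0 := by
  rintro ⟨f, hf, hf1, hf0⟩
  obtain ⟨lam, h1, hsupp, hann⟩ := exists_urect_annihilator_one ha0 ha1 hμ0 hμ1
  have hzero : ∀ g : GLm p 2, g ≠ 1 → lam g * f g = 0 := by
    intro g hg
    by_cases hl : lam g = 0
    · rw [hl, zero_mul]
    · obtain ⟨α, β, x, hα, hβ, hgx⟩ := hsupp g hl
      obtain ⟨a', ha', b, hb, c, hc, habc⟩ := hcell α β hα hβ x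
      have hg' : g = a' * b * c := Units.ext (hgx.trans habc.symm)
      rw [hg', hf0 a' ha' b hb c hc (hg' ▸ hg), mul_zero]
  have h := hann f hf
  rw [Finset.sum_eq_single (1 : GLm p 2) (fun g _ hg => hzero g hg)
    (fun h' => absurd (Finset.mem_univ _) h'), hf1, mul_one] at h
  exact h1 h

/-- Cells through the third member: for `U⁺ ≤ H₁`, `U⁻ ≤ H₂`, `diag(1, δ) = a' b ∈ H₁H₂` and
`s ∈ H₃` with `s₀₀ ≠ 0`, the whole cell `B(s₀₀, δ·det s/s₀₀)` consists of triple products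
(`U⁺ · diag(1,δ) · [[1,0],[-s₁₀/s₀₀,1]] · s`). -/
theorem cell_of_triple {H₁ H₂ H₃ : Subgroup (GLm p 2)}
    (hU : ∀ u : GLm p 2, (u : Mat p 2) 1 0 = 0 → (u : Mat p 2) 0 0 = 1 → (u : Mat p 2) 1 1 = 1 →
      u ∈ H₁)
    (hV : ∀ v : GLm p 2, (v : Mat p 2) 0 1 = 0 → (v : Mat p 2) 0 0 = 1 → (v : Mat p 2) 1 1 = 1 →
      v ∈ H₂)
    {δ : ZMod p} {a' b : GLm p 2} (ha' : a' ∈ H₁) (hb : b ∈ H₂)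
    (hab : ((a' * b : GLm p 2) : Mat p 2) = !![1, 0; 0, δ]) (hδ : δ ≠ 0)
    {s : GLm p 2} (hs : s ∈ H₃) (hs0 : (s : Mat p 2) 0 0 ≠ 0) (x : ZMod p) :
    ∃ a₁ ∈ H₁, ∃ b₁ ∈ H₂, ∃ c ∈ H₃, ((a₁ * b₁ * c : GLm p 2) : Mat p 2) =
      !![(s : Mat p 2) 0 0, x; 0, δ * Matrix.det (s : Mat p 2) / (s : Mat p 2) 0 0] := by
  have hds : Matrix.det (s : Mat p 2) ≠ 0 := Matrix.GeneralLinearGroup.det_ne_zero s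
  set β : ZMod p := δ * Matrix.det (s : Mat p 2) / (s : Mat p 2) 0 0 with hβdef
  have hβ : β ≠ 0 := div_ne_zero (mul_ne_zero hδ hds) hs0
  obtain ⟨v, hv⟩ : ∃ v : GLm p 2,
      (v : Mat p 2) = !![1, 0; -(s : Mat p 2) 1 0 / (s : Mat p 2) 0 0, 1] :=
    ⟨Matrix.GeneralLinearGroup.mkOfDetNeZero _ (by rw [Matrix.det_fin_two_of]; simp), rfl⟩
  obtain ⟨u, hu⟩ : ∃ u : GLm p 2, (u : Mat p 2) = !![1, (x - (s : Mat p 2) 0 1) / β; 0, 1] :=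
    ⟨Matrix.GeneralLinearGroup.mkOfDetNeZero _ (by rw [Matrix.det_fin_two_of]; simp), rfl⟩
  have hvs : ((v * s : GLm p 2) : Mat p 2) =
      !![(s : Mat p 2) 0 0, (s : Mat p 2) 0 1;
        0, Matrix.det (s : Mat p 2) / (s : Mat p 2) 0 0] := by
    rw [Units.val_mul, hv, Matrix.det_fin_two]
    ext i j
    fin_cases i <;> fin_cases j <;> simp [Matrix.mul_apply, Fin.sum_univ_two] <;>
      field_simp <;> ring
  have htvs : (((a' * b) * (v * s) : GLm p 2) : Mat p 2) =
      !![(s : Mat p 2) 0 0, (s : Mat p 2) 0 1; 0, β] := by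
    rw [Units.val_mul, hab, hvs, Matrix.mul_fin_two, hβdef]
    ext i j
    fin_cases i <;> fin_cases j <;> simp [mul_div_assoc]
  refine ⟨u * a', H₁.mul_mem (hU u (by simp [hu]) (by simp [hu]) (by simp [hu])) ha', b * v,
    H₂.mul_mem hb (hV v (by simp [hv]) (by simp [hv]) (by simp [hv])), s, hs, ?_⟩
  have hassoc : u * a' * (b * v) * s = u * ((a' * b) * (v * s)) := by simp only [mul_assoc]
  rw [hassoc, Units.val_mul, htvs, hu, Matrix.mul_fin_two]
  ext i j
  fin_cases i <;> fin_cases j <;> simp [div_mul_cancel₀ _ hβ]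

/-- **TRIPLE RECTANGLE LAW for a frame.**  `U⁺ ≤ H₁`, `U⁻ ≤ H₂`; `diag(1, μ), diag(1, δ₁),
diag(1, δ₂) ∈ H₁H₂` with `δ₁ det s = s₀₀`, `δ₂ det s = μ s₀₀` for some `s ∈ H₃` with
`s₀₀ ∉ {0, 1}` (`μ ∉ {0,1}`): then `(H₁, H₂, H₃)` has no level-1 identity test — the cells over
`{1, s₀₀} × {1, μ}` are triple products.  No TPP hypothesis is needed. -/
theorem no_idTest_triple_frame {H₁ H₂ H₃ : Subgroup (GLm p 2)}
    (hU : ∀ u : GLm p 2, (u : Mat p 2) 1 0 = 0 → (u : Mat p 2) 0 0 = 1 → (u : Mat p 2) 1 1 = 1 →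
      u ∈ H₁)
    (hV : ∀ v : GLm p 2, (v : Mat p 2) 0 1 = 0 → (v : Mat p 2) 0 0 = 1 → (v : Mat p 2) 1 1 = 1 →
      v ∈ H₂)
    {μ : ZMod p} (hμ0 : μ ≠ 0) (hμ1 : μ ≠ 1)
    (hμD : ∃ a' ∈ H₁, ∃ b ∈ H₂, ((a' * b : GLm p 2) : Mat p 2) = !![1, 0; 0, μ])
    {s : GLm p 2} (hs : s ∈ H₃) (hs0 : (s : Mat p 2) 0 0 ≠ 0) (hs1 : (s : Mat p 2) 0 0 ≠ 1)
    {δ₁ δ₂ : ZMod p} (hδ₁ : δ₁ * Matrix.det (s : Mat p 2) = (s : Mat p 2) 0 0)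
    (hδ₂ : δ₂ * Matrix.det (s : Mat p 2) = μ * (s : Mat p 2) 0 0)
    (hδ₁D : ∃ a' ∈ H₁, ∃ b ∈ H₂, ((a' * b : GLm p 2) : Mat p 2) = !![1, 0; 0, δ₁])
    (hδ₂D : ∃ a' ∈ H₁, ∃ b ∈ H₂, ((a' * b : GLm p 2) : Mat p 2) = !![1, 0; 0, δ₂]) :
    ¬ ∃ f ∈ levelSubmodule p 2 1, f 1 = 1 ∧
        ∀ a' ∈ H₁, ∀ b ∈ H₂, ∀ c ∈ H₃, a' * b * c ≠ 1 → f (a' * b * c) = 0 := by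
  have hds : Matrix.det (s : Mat p 2) ≠ 0 := Matrix.GeneralLinearGroup.det_ne_zero s
  have hδ₁0 : δ₁ ≠ 0 := fun h => hs0 (by rw [← hδ₁, h, zero_mul])
  have hδ₂0 : δ₂ ≠ 0 := fun h => mul_ne_zero hμ0 hs0 (by rw [← hδ₂, h, zero_mul])
  refine no_idTest_of_cells_in_triple hs0 hs1 hμ0 hμ1 fun α β hα hβ x => ?_
  rcases hα with hα | hα
  · -- first column `α = 1`: cells inside `H₁H₂ · 1`
    have hdiag : ∃ a' ∈ H₁, ∃ b ∈ H₂, ((a' * b : GLm p 2) : Mat p 2) = !![1, 0; 0, β] := by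
      rcases hβ with hβ | hβ
      · exact ⟨1, H₁.one_mem, 1, H₂.one_mem, by rw [mul_one, coe_one_eq_ucell, hβ]⟩
      · rw [hβ]; exact hμD
    obtain ⟨a', ha', b, hb, hab⟩ := ucell_of_left hU
      (by rcases hβ with hβ | hβ <;> rw [hβ]; exacts [one_ne_zero, hμ0]) hdiag x
    exact ⟨a', ha', b, hb, 1, H₃.one_mem, by rw [mul_one, hab, hα]⟩
  · -- second column `α = s₀₀`: cells through `s`
    rcases hβ with hβ | hβ
    · obtain ⟨a', ha', b, hb, hab⟩ := hδ₁D
      obtain ⟨a₁, ha₁, b₁, hb₁, c, hc, h⟩ := cell_of_triple hU hV ha' hb hab hδ₁0 hs hs0 x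
      refine ⟨a₁, ha₁, b₁, hb₁, c, hc, ?_⟩
      rw [h, hα, hβ, hδ₁, div_self hs0]
    · obtain ⟨a', ha', b, hb, hab⟩ := hδ₂D
      obtain ⟨a₁, ha₁, b₁, hb₁, c, hc, h⟩ := cell_of_triple hU hV ha' hb hab hδ₂0 hs hs0 x
      refine ⟨a₁, ha₁, b₁, hb₁, c, hc, ?_⟩
      rw [h, hα, hβ, hδ₂, mul_div_assoc, div_self hs0, mul_one]

/-- **TRIPLE RECTANGLE LAW in the crux's vocabulary.**  Same hypotheses; the conclusion is the
negation of the design clause of `SubgroupIdentityDesigns` at `(m, k) = (2, 1)`. -/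
theorem no_levelOne_design_triple_frame {H₁ H₂ H₃ : Subgroup (GLm p 2)}
    (hU : ∀ u : GLm p 2, (u : Mat p 2) 1 0 = 0 → (u : Mat p 2) 0 0 = 1 → (u : Mat p 2) 1 1 = 1 →
      u ∈ H₁)
    (hV : ∀ v : GLm p 2, (v : Mat p 2) 0 1 = 0 → (v : Mat p 2) 0 0 = 1 → (v : Mat p 2) 1 1 = 1 →
      v ∈ H₂)
    {μ : ZMod p} (hμ0 : μ ≠ 0) (hμ1 : μ ≠ 1)
    (hμD : ∃ a' ∈ H₁, ∃ b ∈ H₂, ((a' * b : GLm p 2) : Mat p 2) = !![1, 0; 0, μ])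
    {s : GLm p 2} (hs : s ∈ H₃) (hs0 : (s : Mat p 2) 0 0 ≠ 0) (hs1 : (s : Mat p 2) 0 0 ≠ 1)
    {δ₁ δ₂ : ZMod p} (hδ₁ : δ₁ * Matrix.det (s : Mat p 2) = (s : Mat p 2) 0 0)
    (hδ₂ : δ₂ * Matrix.det (s : Mat p 2) = μ * (s : Mat p 2) 0 0)
    (hδ₁D : ∃ a' ∈ H₁, ∃ b ∈ H₂, ((a' * b : GLm p 2) : Mat p 2) = !![1, 0; 0, δ₁])
    (hδ₂D : ∃ a' ∈ H₁, ∃ b ∈ H₂, ((a' * b : GLm p 2) : Mat p 2) = !![1, 0; 0, δ₂]) :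
    ¬ ∃ c : Mat p 2 → ℂ, (∀ M, 1 < M.rank → c M = 0) ∧
        (∑ M, c M * ZMod.stdAddChar (Matrix.trace (M * ((1 : GLm p 2) : Mat p 2)))) = 1 ∧
        ∀ a ∈ H₁, ∀ b ∈ H₂, ∀ g ∈ H₃, a * b * g ≠ 1 →
          (∑ M, c M *
            ZMod.stdAddChar (Matrix.trace (M * ((a * b * g : GLm p 2) : Mat p 2)))) = 0 := by
  rintro ⟨c, hc, hc1, hc0⟩
  refine no_idTest_triple_frame hU hV hμ0 hμ1 hμD hs hs0 hs1 hδ₁ hδ₂ hδ₁D hδ₂D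
    ⟨fourierFn c, fourierFn_mem_levelSubmodule hc, hc1, fun a ha b hb g hg hne => ?_⟩
  exact hc0 a ha b hb g hg hne

/-- **Full-torus corollary.**  If `U⁺ ≤ H₁`, `U⁻ ≤ H₂` and `H₁H₂` contains every `diag(1, δ)`,
`δ ≠ 0` (e.g. `T₁T₂ = {diag(1, δ)}` exhausts `𝔽_p^×`, the top `p = 7` census family), then a
level-1 identity design forces EVERY `s ∈ H₃` to have `s₀₀ ∈ {0, 1}`. -/
theorem no_levelOne_design_fullTorus {H₁ H₂ H₃ : Subgroup (GLm p 2)}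
    (hU : ∀ u : GLm p 2, (u : Mat p 2) 1 0 = 0 → (u : Mat p 2) 0 0 = 1 → (u : Mat p 2) 1 1 = 1 →
      u ∈ H₁)
    (hV : ∀ v : GLm p 2, (v : Mat p 2) 0 1 = 0 → (v : Mat p 2) 0 0 = 1 → (v : Mat p 2) 1 1 = 1 →
      v ∈ H₂)
    (hT : ∀ δ : ZMod p, δ ≠ 0 →
      ∃ a' ∈ H₁, ∃ b ∈ H₂, ((a' * b : GLm p 2) : Mat p 2) = !![1, 0; 0, δ])
    {s : GLm p 2} (hs : s ∈ H₃) (hs0 : (s : Mat p 2) 0 0 ≠ 0) (hs1 : (s : Mat p 2) 0 0 ≠ 1) :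
    ¬ ∃ c : Mat p 2 → ℂ, (∀ M, 1 < M.rank → c M = 0) ∧
        (∑ M, c M * ZMod.stdAddChar (Matrix.trace (M * ((1 : GLm p 2) : Mat p 2)))) = 1 ∧
        ∀ a ∈ H₁, ∀ b ∈ H₂, ∀ g ∈ H₃, a * b * g ≠ 1 →
          (∑ M, c M *
            ZMod.stdAddChar (Matrix.trace (M * ((a * b * g : GLm p 2) : Mat p 2)))) = 0 := by
  have hds : Matrix.det (s : Mat p 2) ≠ 0 := Matrix.GeneralLinearGroup.det_ne_zero s
  set a : ZMod p := (s : Mat p 2) 0 0 with ha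
  refine no_levelOne_design_triple_frame hU hV hs0 hs1 (hT a hs0) hs hs0 hs1
    (δ₁ := a / Matrix.det (s : Mat p 2)) (δ₂ := a * a / Matrix.det (s : Mat p 2))
    (div_mul_cancel₀ _ hds) (div_mul_cancel₀ _ hds)
    (hT _ (div_ne_zero hs0 hds)) (hT _ (div_ne_zero (mul_ne_zero hs0 hs0) hds))

end TripleCells

end Summit.MatrixMultiplication.MatrixMultiplication.Theorems.SubgroupIdentityDesigns.Negative

end
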